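import Literature.MathematicalPhysics.QuantumFieldTheory.LatticeGaugeAsymptoticsFreeEnergyProofs
import HarnessLib

/-!
# Axial (comb) gauge on cubes of `ℤ^d`: gauge fixing under product Haar measure, the discrete
# Poincaré inequality, edge counts

Infrastructure for the weak-coupling analysis of lattice gauge theory on the cubes
`B_n = [0, n)^d` with free boundary condition (S. Chatterjee, *The leading term of the Yang–Mills
free energy*, J. Funct. Anal. 271 (2016), arXiv:1602.01222, §§2, 9, 10, 13, 17), second step of
the inline proof of the named fact
`Literature.MathematicalPhysics.QuantumFieldTheory.chatterjee_freeEnergyDensity`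
(`LatticeGaugeAsymptotics.lean`). Everything is proved for a general (compact, second countable)
group `G`; no named fact is introduced. Objects of `Sweep1` (`ZdGaugeConfig`, `ZdGaugeConfig.line`,
`ZdGaugeConfig.plaquette`, `zdWilsonAction`, `zdHaar`, `zdPartitionFunction`, `plaquettesIn`,
`halfOpenBox`) and of `LatticeGaugeDLR` (`gaugeTransformZd`) are used as they are.

* `AxialGauge.boxEdges d n` (`E_n`), `IsComb` (the comb tree `E_n^0`: edges `(x, i)` with
  `x_k = 0` for `k > i`), `combEdges`, `freeEdges` (`E_n^1`), `l1` (`|x|₁`).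
* `combGauge U x` (`G_U(x)`, the holonomy along the comb path), `combGauge_add_single`
  (**Prop. 9.2**: `G_U(x + eᵢ) = G_U(x) U(x,i)` across comb edges), `combGauge_congr` (it only reads
  comb edges), `gaugeFix`, `gaugeFix_of_isComb`.
* `sq_le_l1_mul_sum`: the **discrete nonlinear Poincaré inequality** (Lemma 10.2; additive form
  Lemma 13.1) in abstract form: for a length function `ℓ` on `G` and a configuration with `ℓ = 0`
  on the comb edges of `B_n`, `ℓ(U(x,j))² ≤ |x|₁ Σ_{p ∈ B_n'} ℓ(U_p)²` (proved by the printed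
  induction on `|x|₁` with the plaquette `(x - e_k, j, k)`; the square/`|x|₁` form avoids lists of
  plaquettes).
* `BoxCfg`, `FreeCfg`, `ext`, `ext₁`, `lintegral_zdHaar_eq_pi` and
  `zdPartitionFunction_eq_lintegral_pi` (**reduction** of `Z(B_n, β)` to the finite product Haar
  measure on `G^{E_n}`, Mathlib `lintegral_restrict_infinitePi`), `map_freePart_pi`
  (**Lemma 9.3**: the free part of the gauge-fixed configuration is product-Haar distributed,
  via `MeasurePreserving.skew_product`), `lintegral_pi_eq_lintegral_free` (**Cor. 9.4**),
  `zdWilsonAction_gaugeTransformZd` (**Prop. 9.1**), `zdWilsonAction_ext_gaugeFixBox`.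
* `card_boxEdges` (`|E_n| = d(n-1)n^{d-1}`), `card_combEdges` (`|E_n^0| = n^d - 1`, the endpoint
  map being a bijection onto `B_n ∖ {0}`), `card_freeEdges` (**Lemma 17.1**:
  `|E_n^1| = (d-1)n^d - d n^{d-1} + 1`), `card_freeEdges_le`, `l1_le`, `card_plaquettesIn_le`.

Not here: anything specific to `U(N)` (the specialisation of the Poincaré inequality to
`ℓ = ‖1 - ·‖_F`, Theorem 10.1) — that is the next file.

## References

* S. Chatterjee, *The leading term of the Yang–Mills free energy*, J. Funct. Anal. 271 (2016)
  2944–3005, arXiv:1602.01222, §2 (`E_n`, `E_n^0`, `E_n^1`), §9 (Prop. 9.1, 9.2, Lemma 9.3,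
  Cor. 9.4), §10 (Lemma 10.2), §13 (Lemma 13.1), §17 (Lemma 17.1). [arXiv160201222]
-/

noncomputable section

open Finset Function
open Literature.Probability.LatticeModels Literature.MathematicalPhysics.QuantumLattice

namespace Literature.MathematicalPhysics.QuantumFieldTheory

namespace AxialGauge

variable {d : ℕ} {G : Type*} [Group G]

/-- Sites of `ℤ^d` (the `StatMech` `Site d = Fin d → ℤ`; the bare name `Site` denotes torus sites in
this namespace). -/
local notation "ZSite" => Literature.Probability.LatticeModels.Site

/-! ### Edges of a box, the comb tree -/

/-- The positively oriented edges of the cube `B_n = [0, n)^d`: `(x, i)` with `x` and `x + eᵢ`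
in `B_n` (Chatterjee arXiv:1602.01222 §2, the set `E_n`). [cite: arXiv160201222, §2] -/
def boxEdges (d n : ℕ) : Finset (ZdEdge d) :=
  (halfOpenBox d n ×ˢ univ).filter fun e => e.1 + Pi.single e.2 1 ∈ halfOpenBox d n

/-- Membership in `boxEdges`. [cite: arXiv160201222, §2] -/
theorem mem_boxEdges {n : ℕ} {e : ZdEdge d} :
    e ∈ boxEdges d n ↔ e.1 ∈ halfOpenBox d n ∧ e.1 + Pi.single e.2 1 ∈ halfOpenBox d n := by
  simp [boxEdges]

/-- Coordinate description of `boxEdges`: all coordinates in `[0, n)` and the `i`-th one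
`< n - 1`. [cite: arXiv160201222, §2] -/
theorem mem_boxEdges_iff {n : ℕ} {x : ZSite d} {i : Fin d} :
    (x, i) ∈ boxEdges d n ↔ (∀ k, 0 ≤ x k ∧ x k < n) ∧ x i + 1 < n := by
  rw [mem_boxEdges, mem_halfOpenBox, mem_halfOpenBox]
  constructor
  · rintro ⟨h1, h2⟩
    refine ⟨h1, ?_⟩
    have := (h2 i).2
    simpa using this
  · rintro ⟨h1, h2⟩
    refine ⟨h1, fun k => ?_⟩
    by_cases hk : k = i
    · subst hk; simp; constructor <;> linarith [(h1 k).1]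
    · simp [Pi.single_eq_of_ne hk]; exact h1 k

/-- The edges of the **comb tree** (axial gauge): `(x, i)` with `x_k = 0` for all `k > i`
(Chatterjee arXiv:1602.01222 §2, the set `E_n^0`: edges from `(x₁,…,x_j,0,…,0)` to
`(x₁,…,x_j + 1,0,…,0)`). [cite: arXiv160201222, §2] -/
def IsComb (e : ZdEdge d) : Prop := ∀ k : Fin d, e.2 < k → e.1 k = 0

/-- Being a comb edge is decidable. [folklore] -/
instance instDecidablePredIsComb : DecidablePred (IsComb (d := d)) := fun _ => by
  unfold IsComb; infer_instance

/-- The `ℓ¹` size `|x|₁ = Σ_k x_k` of a site with non-negative coordinates (as a natural number;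
negative coordinates are truncated). [cite: arXiv160201222, §10] -/
def l1 (x : ZSite d) : ℕ := ∑ k, (x k).toNat

/-! ### Straight lines and the comb gauge -/

/-- Appending one step to a straight line:
`line k (m+1) y = line k m y · U(y + m eₖ, k)`. [folklore] -/
theorem line_succ_right (U : ZdGaugeConfig d G) (k : Fin d) :
    ∀ (m : ℕ) (y : ZSite d), U.line k (m + 1) y = U.line k m y * U (y + Pi.single k (m : ℤ), k)
  | 0, y => by simp [ZdGaugeConfig.line]
  | m + 1, y => by
    rw [ZdGaugeConfig.line, line_succ_right U k m (y + Pi.single k 1), ZdGaugeConfig.line, mul_assoc]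
    congr 2
    rw [add_assoc, ← Pi.single_add]
    push_cast
    ring_nf

/-- A straight line only reads the edges it traverses. [folklore] -/
theorem line_congr {U U' : ZdGaugeConfig d G} (k : Fin d) :
    ∀ (m : ℕ) (y : ZSite d), (∀ t : ℕ, t < m → U (y + Pi.single k (t : ℤ), k) = U' (y + Pi.single k (t : ℤ), k)) →
      U.line k m y = U'.line k m y
  | 0, y, _ => by simp [ZdGaugeConfig.line]
  | m + 1, y, h => by
    rw [line_succ_right, line_succ_right, line_congr k m y fun t ht => h t (Nat.lt_succ_of_lt ht),
      h m (Nat.lt_succ_self m)]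

/-- The base point `(x₁, …, x_{i-1}, 0, …, 0)` of the `i`-th leg of the comb path to `x`. [cite: arXiv160201222, §9] -/
def combBase (i : Fin d) (x : ZSite d) : ZSite d := fun k => if k < i then x k else 0

/-- The partial comb holonomies: `combGaugeAux U x j` is the ordered product of the first `j` legs
of the comb path from `0` to `x` (leg `i` runs `x_i` steps in direction `i` from `combBase i x`). [cite: arXiv160201222, §9] -/
def combGaugeAux (U : ZdGaugeConfig d G) (x : ZSite d) : ℕ → G
  | 0 => 1
  | j + 1 => combGaugeAux U x j *
      (if h : j < d then U.line ⟨j, h⟩ (x ⟨j, h⟩).toNat (combBase ⟨j, h⟩ x) else 1)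

/-- **The comb (axial) gauge** `G_U(x)`: the holonomy of `U` along the comb path from `0` to `x`
(first along `e₀`, then `e₁`, …; Chatterjee arXiv:1602.01222 §9, the gauge transform `G_U`,
defined there recursively by `G_U(x) = G_U(x - e_j) U(x - e_j, x)`, `j` the largest index with
`x_j ≠ 0`). [cite: arXiv160201222, §9] -/
def combGauge (U : ZdGaugeConfig d G) (x : ZSite d) : G := combGaugeAux U x d

/-- `combBase i` ignores the coordinates `≥ i`. [folklore] -/
theorem combBase_add_single_of_le {i j : Fin d} (hij : i ≤ j) (x : ZSite d) (c : ℤ) :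
    combBase i (x + Pi.single j c) = combBase i x := by
  ext k
  simp only [combBase, Pi.add_apply]
  split_ifs with hk
  · rw [Pi.single_eq_of_ne (ne_of_lt (lt_of_lt_of_le hk hij)), add_zero]
  · rfl

/-- For a comb edge `(x, i)` with `x_i ≥ 0`: `combBase i x + x_i eᵢ = x`. [folklore] -/
theorem combBase_add_eq {x : ZSite d} {i : Fin d} (hc : IsComb (x, i)) (hx : 0 ≤ x i) :
    combBase i x + Pi.single i ((x i).toNat : ℤ) = x := by
  ext k
  simp only [combBase, Pi.add_apply]
  rcases lt_trichotomy k i with hk | rfl | hk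
  · simp [hk, Pi.single_eq_of_ne (ne_of_lt hk)]
  · simp [Int.toNat_of_nonneg hx]
  · rw [if_neg (not_lt.2 hk.le), Pi.single_eq_of_ne (ne_of_gt hk), zero_add]
    exact (hc k hk).symm

/-- **Prop. 9.2 (recursion of the comb gauge)**: across a comb edge `(x, i)` (with `x_i ≥ 0`),
`G_U(x + eᵢ) = G_U(x) U(x, i)`. [cite: arXiv160201222, Prop. 9.2] -/
theorem combGauge_add_single {U : ZdGaugeConfig d G} {x : ZSite d} {i : Fin d} (hc : IsComb (x, i))
    (hx : 0 ≤ x i) : combGauge U (x + Pi.single i 1) = combGauge U x * U (x, i) := by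
  -- by induction on the number of legs
  suffices h : ∀ j : ℕ, combGaugeAux U (x + Pi.single i 1) j =
      if j ≤ i then combGaugeAux U x j else combGaugeAux U x j * U (x, i) by
    have := h d
    rw [if_neg (not_le.2 i.2)] at this
    exact this
  intro j
  induction j with
  | zero => simp [combGaugeAux]
  | succ j ih =>
    simp only [combGaugeAux, ih]
    by_cases hjd : j < d
    · rw [dif_pos hjd, dif_pos hjd]
      rcases lt_trichotomy (⟨j, hjd⟩ : Fin d) i with hji | hji | hji
      · -- leg below `i`: unchanged
        have h1 : j ≤ (i : ℕ) := le_of_lt hji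
        have h2 : j + 1 ≤ (i : ℕ) := hji
        rw [if_pos h1, if_pos h2, combBase_add_single_of_le hji.le]
        simp [Pi.add_apply, Pi.single_eq_of_ne (ne_of_lt hji)]
      · -- leg `i`: one more step
        subst hji
        have h1 : j ≤ ((⟨j, hjd⟩ : Fin d) : ℕ) := le_rfl
        have h2 : ¬ (j + 1 ≤ ((⟨j, hjd⟩ : Fin d) : ℕ)) := by simp
        rw [if_pos h1, if_neg h2, combBase_add_single_of_le le_rfl, mul_assoc]
        congr 1
        simp only [Pi.add_apply, Pi.single_eq_same]
        rw [show (x ⟨j, hjd⟩ + 1).toNat = (x ⟨j, hjd⟩).toNat + 1 by omega, line_succ_right,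
          combBase_add_eq hc hx]
      · -- leg above `i`: empty in both cases
        have h1 : ¬ (j ≤ (i : ℕ)) := not_le.2 hji
        have h2 : ¬ (j + 1 ≤ (i : ℕ)) := by omega
        rw [if_neg h1, if_neg h2]
        have hz : x ⟨j, hjd⟩ = 0 := hc _ hji
        have hne : (⟨j, hjd⟩ : Fin d) ≠ i := ne_of_gt hji
        simp [hz, Pi.single_eq_of_ne hne, ZdGaugeConfig.line]
    · rw [dif_neg hjd, dif_neg hjd]
      have h1 : ¬ (j ≤ (i : ℕ)) := by omega
      have h2 : ¬ (j + 1 ≤ (i : ℕ)) := by omega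
      rw [if_neg h1, if_neg h2, mul_one, mul_one]

/-- The comb gauge only reads comb edges. [cite: arXiv160201222, Lemma 9.3 (proof)] -/
theorem combGauge_congr {U U' : ZdGaugeConfig d G} (h : ∀ e : ZdEdge d, IsComb e → U e = U' e)
    (x : ZSite d) : combGauge U x = combGauge U' x := by
  suffices hj : ∀ j, combGaugeAux U x j = combGaugeAux U' x j from hj d
  intro j
  induction j with
  | zero => rfl
  | succ j ih =>
    simp only [combGaugeAux, ih]
    by_cases hjd : j < d
    · rw [dif_pos hjd, dif_pos hjd, line_congr _ _ _ fun t _ => h _ ?_]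
      intro k hk
      simp only [Pi.add_apply, combBase]
      rw [if_neg (not_lt.2 (le_of_lt hk)), Pi.single_eq_of_ne (ne_of_gt hk), add_zero]
    · rw [dif_neg hjd, dif_neg hjd]

/-! ### Gauge fixing -/

/-- The axially gauge-fixed configuration `G_U · U` (Chatterjee arXiv:1602.01222 §9). [cite: arXiv160201222, §9] -/
def gaugeFix (U : ZdGaugeConfig d G) : ZdGaugeConfig d G := gaugeTransformZd (combGauge U) U

/-- **Prop. 9.2**: the gauge-fixed configuration is `1` on comb edges (with non-negative
`i`-th coordinate). [cite: arXiv160201222, Prop. 9.2] -/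
theorem gaugeFix_of_isComb {U : ZdGaugeConfig d G} {x : ZSite d} {i : Fin d} (hc : IsComb (x, i))
    (hx : 0 ≤ x i) : gaugeFix U (x, i) = 1 := by
  simp only [gaugeFix, gaugeTransformZd, combGauge_add_single hc hx]
  group

/-- Off the comb tree: `(G_U · U)(x,i) = G_U(x) U(x,i) G_U(x+eᵢ)⁻¹`. [cite: arXiv160201222, §9] -/
theorem gaugeFix_apply (U : ZdGaugeConfig d G) (e : ZdEdge d) :
    gaugeFix U e = combGauge U e.1 * U e * (combGauge U (e.1 + Pi.single e.2 1))⁻¹ := rfl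

/-- Plaquette holonomies of the gauge-fixed configuration are conjugates of the original ones. [cite: arXiv160201222, Prop. 9.1] -/
theorem plaquette_gaugeFix (U : ZdGaugeConfig d G) (x : ZSite d) (i j : Fin d) :
    (gaugeFix U).plaquette x i j = combGauge U x * U.plaquette x i j * (combGauge U x)⁻¹ :=
  plaquetteHolonomyZd_gaugeTransformZd _ U x i j

/-! ### The discrete nonlinear Poincaré inequality (Lemma 10.2 / Lemma 13.1) -/

/-- `|x + e_k|₁ = |x|₁ + 1` when `x_k ≥ 0`. [folklore] -/
theorem l1_add_single {x : ZSite d} {k : Fin d} (hx : 0 ≤ x k) : l1 (x + Pi.single k 1) = l1 x + 1 := by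
  have h : ∀ k', (x k' + (Pi.single k (1 : ℤ) : ZSite d) k').toNat =
      (x k').toNat + if k' = k then 1 else 0 := by
    intro k'
    by_cases hk : k' = k
    · subst hk; rw [Pi.single_eq_same, if_pos rfl]; omega
    · rw [Pi.single_eq_of_ne hk, if_neg hk, add_zero, add_zero]
  simp only [l1, Pi.add_apply, h, Finset.sum_add_distrib, Finset.sum_ite_eq', Finset.mem_univ,
    if_true]

/-- `|x|₁ = 0` forces `x = 0` on the box. [folklore] -/
theorem eq_zero_of_l1_eq_zero {x : ZSite d} (hx : ∀ k, 0 ≤ x k) (h : l1 x = 0) (k : Fin d) : x k = 0 := by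
  unfold l1 at h
  have := (Finset.sum_eq_zero_iff.1 h) k (Finset.mem_univ _)
  have := hx k
  omega

/-- The elementary step `a² ≤ m S ⟹ (a + b)² ≤ (m + 1)(S + b²)` of the induction. [folklore] -/
theorem sq_add_le_of_sq_le {m S a b : ℝ} (hm : 0 ≤ m) (hS : 0 ≤ S) (ha : 0 ≤ a)
    (h : a ^ 2 ≤ m * S) : (a + b) ^ 2 ≤ (m + 1) * (S + b ^ 2) := by
  rcases eq_or_lt_of_le hm with rfl | hm'
  · have ha0 : a = 0 := by nlinarith
    subst ha0; nlinarith
  · -- `m ((m+1)(S+b²) - (a+b)²) ≥ (a - m b)² ≥ 0`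
    have key : m * ((m + 1) * (S + b ^ 2) - (a + b) ^ 2) ≥ (a - m * b) ^ 2 := by nlinarith
    have h2 : 0 ≤ m * ((m + 1) * (S + b ^ 2) - (a + b) ^ 2) := le_trans (sq_nonneg _) key
    nlinarith [(mul_nonneg_iff_of_pos_left hm').1 h2]

/-- **The discrete nonlinear Poincaré inequality** (Chatterjee arXiv:1602.01222 Lemma 10.2 and,
for the additive group `ℝ`, Lemma 13.1), abstract form. Let `ℓ ≥ 0` be a length function on the
group `G` (`ℓ(ab) ≤ ℓ(a) + ℓ(b)`, `ℓ(a⁻¹) = ℓ(a)`) and let `U` be a configuration with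
`ℓ(U_e) = 0` on the comb-tree edges of the cube `B_n`. Then for every edge `(x, j)` of `B_n`,
`ℓ(U(x,j))² ≤ |x|₁ · Σ_{p ∈ B_n'} ℓ(U_p)²`. (The printed statement is
`‖1 - U(x,y)‖ ≤ (2|x|₁ S(U))^{1/2}`, resp. `|s(x,y)| ≤ |x|₁ √M_n(s)`; the induction on `|x|₁` is the
printed one, the plaquette `(x - e_k, j, k)`, `k` the largest index with `x_k ≠ 0`, having two comb
edges.) [cite: arXiv160201222, Lemma 10.2] -/
theorem sq_le_l1_mul_sum {ℓ : G → ℝ} (hnn : ∀ a, 0 ≤ ℓ a) (hmul : ∀ a b, ℓ (a * b) ≤ ℓ a + ℓ b)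
    (hinv : ∀ a, ℓ a⁻¹ = ℓ a) {n : ℕ} {U : ZdGaugeConfig d G}
    (hU : ∀ e ∈ boxEdges d n, IsComb e → ℓ (U e) = 0) {e : ZdEdge d} (he : e ∈ boxEdges d n) :
    ℓ (U e) ^ 2 ≤ l1 e.1 * ∑ p ∈ plaquettesIn (halfOpenBox d n), ℓ (U.plaquette p.1 p.2.1 p.2.2) ^ 2 := by
  -- strengthen: only plaquettes with base point of smaller `|·|₁` are needed
  set P := plaquettesIn (halfOpenBox d n) with hP
  suffices H : ∀ (m : ℕ) (x : ZSite d) (j : Fin d), (x, j) ∈ boxEdges d n → l1 x = m →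
      ℓ (U (x, j)) ^ 2 ≤ m * ∑ p ∈ P.filter (fun p => l1 p.1 < m), ℓ (U.plaquette p.1 p.2.1 p.2.2) ^ 2 by
    obtain ⟨x, j⟩ := e
    refine (H _ x j he rfl).trans (mul_le_mul_of_nonneg_left ?_ (Nat.cast_nonneg _))
    exact Finset.sum_le_sum_of_subset_of_nonneg (filter_subset _ _) fun p _ _ => sq_nonneg _
  intro m
  induction m using Nat.strong_induction_on with
  | _ m ih =>
  intro x j hxj hm
  have hsum_nn : ∀ s : Finset (Plaq d), 0 ≤ ∑ p ∈ s, ℓ (U.plaquette p.1 p.2.1 p.2.2) ^ 2 :=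
    fun s => Finset.sum_nonneg fun p _ => sq_nonneg _
  by_cases hc : IsComb (x, j)
  · rw [hU _ hxj hc]
    simpa using mul_nonneg (Nat.cast_nonneg m) (hsum_nn _)
  -- the largest index `k` with `x_k ≠ 0`; it exceeds `j`
  obtain ⟨hbox, hxjn⟩ := mem_boxEdges_iff.1 hxj
  have hne : (univ.filter fun k : Fin d => x k ≠ 0).Nonempty := by
    simp only [IsComb, not_forall, exists_prop] at hc
    obtain ⟨k, -, hk⟩ := hc
    exact ⟨k, mem_filter.2 ⟨mem_univ _, hk⟩⟩
  set k := (univ.filter fun k : Fin d => x k ≠ 0).max' hne with hk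
  have hkx : x k ≠ 0 := (mem_filter.1 (Finset.max'_mem _ hne)).2
  have hkmax : ∀ k' : Fin d, k < k' → x k' = 0 := fun k' hk' => by
    by_contra h
    exact absurd (Finset.le_max' _ k' (mem_filter.2 ⟨mem_univ _, h⟩)) (not_le.2 hk')
  have hjk : j < k := by
    by_contra h
    simp only [IsComb, not_forall, exists_prop] at hc
    obtain ⟨k', hk', hk'0⟩ := hc
    exact hk'0 (hkmax k' (lt_of_le_of_lt (not_lt.1 h) hk'))
  have hxk : 1 ≤ x k := by have := (hbox k).1; omega
  -- the predecessor `z = x - e_k`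
  set z : ZSite d := x - Pi.single k 1 with hz
  have hxz : x = z + Pi.single k 1 := by rw [hz, sub_add_cancel]
  have hzk : 0 ≤ z k := by simp [hz]; omega
  have hzc : ∀ k' : Fin d, k' ≠ k → z k' = x k' := fun k' hk' => by simp [hz, Pi.single_eq_of_ne hk']
  have hzbox : ∀ k', 0 ≤ z k' ∧ z k' < n := fun k' => by
    by_cases h : k' = k
    · subst h; constructor <;> [exact hzk; (simp [hz]; linarith [(hbox k).2])]
    · rw [hzc k' h]; exact hbox k'
  have hzj : (z, j) ∈ boxEdges d n :=
    mem_boxEdges_iff.2 ⟨hzbox, by rw [hzc j (ne_of_lt hjk)]; exact hxjn⟩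
  -- `|z|₁ = m - 1`
  have hl1 : l1 x = l1 z + 1 := by rw [hxz, l1_add_single hzk]
  have hm' : l1 z = m - 1 := by omega
  have hm1 : 1 ≤ m := by omega
  -- the two comb edges of the plaquette `(z, j, k)`
  have hc1 : IsComb (z, k) := fun k' hk' => by
    dsimp only at hk' ⊢
    rw [hzc k' (ne_of_gt hk')]; exact hkmax k' hk'
  have hc2 : IsComb (z + Pi.single j 1, k) := fun k' hk' => by
    dsimp only at hk' ⊢
    rw [Pi.add_apply, Pi.single_eq_of_ne (ne_of_gt (hjk.trans hk')), add_zero, hzc k' (ne_of_gt hk')]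
    exact hkmax k' hk'
  have he1 : (z, k) ∈ boxEdges d n :=
    mem_boxEdges_iff.2 ⟨hzbox, by simp [hz]; exact (hbox k).2⟩
  have he2 : (z + Pi.single j 1, k) ∈ boxEdges d n := by
    refine mem_boxEdges_iff.2 ⟨fun k' => ?_, ?_⟩
    · by_cases h : k' = j
      · subst h
        simp only [Pi.add_apply, Pi.single_eq_same, hzc _ (ne_of_lt hjk)]
        constructor <;> linarith [(hbox k').1]
      · rw [Pi.add_apply, Pi.single_eq_of_ne h, add_zero]; exact hzbox k'
    · simp only [Pi.add_apply, Pi.single_eq_of_ne (ne_of_gt hjk), add_zero]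
      simp [hz]; exact (hbox k).2
  -- the plaquette `p₀ = (z, j, k)` lies in `B_n`
  have hp₀ : ((z, j, k) : Plaq d) ∈ P := by
    rw [hP, Plaq.mem_plaquettesIn]
    refine ⟨mem_halfOpenBox.2 hzbox, hjk, (mem_boxEdges.1 hzj).2, ?_, ?_⟩
    · rw [← hxz]; exact mem_halfOpenBox.2 hbox
    · dsimp only
      rw [add_right_comm, ← hxz]
      exact (mem_boxEdges.1 hxj).2
  -- holonomy algebra: `ℓ(U(x,j)) ≤ ℓ(U(z,j)) + ℓ(U_{p₀})`
  have hhol : U.plaquette z j k = U (z, j) * U (z + Pi.single j 1, k) * (U (x, j))⁻¹ * (U (z, k))⁻¹ := by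
    rw [ZdGaugeConfig.plaquette, ← hxz]
  have hstep : ℓ (U (x, j)) ≤ ℓ (U (z, j)) + ℓ (U.plaquette z j k) := by
    have e1 : (U (x, j))⁻¹ = (U (z + Pi.single j 1, k))⁻¹ * (U (z, j))⁻¹ * U.plaquette z j k * U (z, k) := by
      rw [hhol]; group
    calc ℓ (U (x, j)) = ℓ (U (x, j))⁻¹ := (hinv _).symm
      _ ≤ ℓ ((U (z + Pi.single j 1, k))⁻¹ * (U (z, j))⁻¹ * U.plaquette z j k) + ℓ (U (z, k)) := by
          rw [e1]; exact hmul _ _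
      _ ≤ ℓ ((U (z + Pi.single j 1, k))⁻¹ * (U (z, j))⁻¹) + ℓ (U.plaquette z j k) + ℓ (U (z, k)) := by
          gcongr; exact hmul _ _
      _ ≤ ℓ (U (z + Pi.single j 1, k))⁻¹ + ℓ (U (z, j))⁻¹ + ℓ (U.plaquette z j k) + ℓ (U (z, k)) := by
          gcongr; exact hmul _ _
      _ = ℓ (U (z, j)) + ℓ (U.plaquette z j k) := by
          rw [hinv, hinv, hU _ he2 hc2, hU _ he1 hc1]; ring
  -- induction hypothesis at `(z, j)`
  have ih' := ih (m - 1) (by omega) z j hzj hm'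
  set S' := ∑ p ∈ P.filter (fun p => l1 p.1 < m - 1), ℓ (U.plaquette p.1 p.2.1 p.2.2) ^ 2 with hS'
  have hb := sq_add_le_of_sq_le (b := ℓ (U.plaquette z j k)) (by positivity) (hsum_nn _) (hnn _) ih'
  -- `S' + ℓ(U_{p₀})² ≤ Σ_{|·|₁ < m}` (the plaquette `p₀` has `|z|₁ = m - 1`)
  have hsub : S' + ℓ (U.plaquette z j k) ^ 2 ≤
      ∑ p ∈ P.filter (fun p => l1 p.1 < m), ℓ (U.plaquette p.1 p.2.1 p.2.2) ^ 2 := by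
    have hmem : ((z, j, k) : Plaq d) ∈ P.filter (fun p => l1 p.1 < m) :=
      mem_filter.2 ⟨hp₀, by change l1 z < m; omega⟩
    have hnot : ((z, j, k) : Plaq d) ∉ P.filter (fun p => l1 p.1 < m - 1) := by
      intro h; have := (mem_filter.1 h).2; change l1 z < m - 1 at this; omega
    rw [← Finset.add_sum_erase _ _ hmem]
    have hS'le : S' ≤ ∑ p ∈ (P.filter (fun p => l1 p.1 < m)).erase (z, j, k),
        ℓ (U.plaquette p.1 p.2.1 p.2.2) ^ 2 := by
      refine Finset.sum_le_sum_of_subset_of_nonneg (fun p hp => ?_) fun p _ _ => sq_nonneg _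
      obtain ⟨hp1, hp2⟩ := mem_filter.1 hp
      exact mem_erase.2 ⟨fun h => hnot (h ▸ hp), mem_filter.2 ⟨hp1, by omega⟩⟩
    linarith
  have hm_cast : ((m - 1 : ℕ) : ℝ) + 1 = m := by
    rw [Nat.cast_sub hm1]; push_cast; ring
  calc ℓ (U (x, j)) ^ 2 ≤ (ℓ (U (z, j)) + ℓ (U.plaquette z j k)) ^ 2 := pow_le_pow_left₀ (hnn _) hstep 2
    _ ≤ (((m - 1 : ℕ) : ℝ) + 1) * (S' + ℓ (U.plaquette z j k) ^ 2) := hb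
    _ = (m : ℝ) * (S' + ℓ (U.plaquette z j k) ^ 2) := by rw [hm_cast]
    _ ≤ (m : ℝ) * ∑ p ∈ P.filter (fun p => l1 p.1 < m), ℓ (U.plaquette p.1 p.2.1 p.2.2) ^ 2 :=
        mul_le_mul_of_nonneg_left hsub (Nat.cast_nonneg m)

/-! ### Configurations on the edges of a box -/

section BoxCfgBasics

variable (d G) in
/-- Configurations on the edges of the cube `B_n` (Chatterjee arXiv:1602.01222 §2, `U(B_n)`). [cite: arXiv160201222, §2] -/
abbrev BoxCfg (n : ℕ) : Type _ := ↥(boxEdges d n) → G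

variable (d G) in
/-- The configurations on the non-comb ("free") edges `E_n^1` of `B_n`
(Chatterjee arXiv:1602.01222 §9, `U_0(B_n) ≅ G^{E_n^1}`). [cite: arXiv160201222, §9] -/
abbrev FreeCfg (n : ℕ) : Type _ := {e : ↥(boxEdges d n) // ¬ IsComb e.1} → G

variable {n : ℕ}

/-- Extension of a box configuration to `ℤ^d` by `1`. [folklore] -/
def ext (u : BoxCfg d G n) : ZdGaugeConfig d G := fun e => if h : e ∈ boxEdges d n then u ⟨e, h⟩ else 1

/-- `ext u` on a box edge. [folklore] -/
theorem ext_apply_of_mem (u : BoxCfg d G n) {e : ZdEdge d} (h : e ∈ boxEdges d n) :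
    ext u e = u ⟨e, h⟩ := dif_pos h

/-- `ext u` off the box. [folklore] -/
theorem ext_apply_of_not_mem (u : BoxCfg d G n) {e : ZdEdge d} (h : e ∉ boxEdges d n) :
    ext u e = 1 := dif_neg h

/-- `ext u` restricted to the box is `u`. [folklore] -/
@[simp] theorem ext_coe (u : BoxCfg d G n) (e : ↥(boxEdges d n)) : ext u e = u e := by
  rw [ext_apply_of_mem u e.2]

/-- `ext (U|_{box})` agrees with `U` on the box. [folklore] -/
theorem ext_restrict_apply (U : ZdGaugeConfig d G) {e : ZdEdge d} (h : e ∈ boxEdges d n) :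
    ext ((boxEdges d n).restrict U) e = U e := by
  rw [ext_apply_of_mem _ h]; rfl

/-- The four edges of a plaquette of `B_n` are edges of `B_n`. [cite: arXiv160201222, §2] -/
theorem edges_mem_boxEdges {p : Plaq d} (hp : p ∈ plaquettesIn (halfOpenBox d n)) :
    (p.1, p.2.1) ∈ boxEdges d n ∧ (p.1 + Pi.single p.2.1 1, p.2.2) ∈ boxEdges d n ∧
      (p.1 + Pi.single p.2.2 1, p.2.1) ∈ boxEdges d n ∧ (p.1, p.2.2) ∈ boxEdges d n := by
  obtain ⟨h1, -, h2, h3, h4⟩ := Plaq.mem_plaquettesIn.1 hp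
  refine ⟨mem_boxEdges.2 ⟨h1, h2⟩, mem_boxEdges.2 ⟨h2, h4⟩, mem_boxEdges.2 ⟨h3, ?_⟩,
    mem_boxEdges.2 ⟨h1, h3⟩⟩
  rwa [add_right_comm]

/-- Plaquette holonomies only read the four plaquette edges. [folklore] -/
theorem plaquette_congr {U V : ZdGaugeConfig d G} {x : ZSite d} {i j : Fin d}
    (h1 : U (x, i) = V (x, i)) (h2 : U (x + Pi.single i 1, j) = V (x + Pi.single i 1, j))
    (h3 : U (x + Pi.single j 1, i) = V (x + Pi.single j 1, i)) (h4 : U (x, j) = V (x, j)) :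
    U.plaquette x i j = V.plaquette x i j := by
  simp only [ZdGaugeConfig.plaquette, h1, h2, h3, h4]

/-- Extension of a free-edge configuration by `1` on the comb tree (an element of `U_0(B_n)`). [cite: arXiv160201222, §9] -/
def ext₁ (v : FreeCfg d G n) : BoxCfg d G n := fun e => if h : IsComb e.1 then 1 else v ⟨e, h⟩

/-- The gauge-fixed box configuration `(G_U · U)|_{E_n}`. [cite: arXiv160201222, §9] -/
def gaugeFixBox (u : BoxCfg d G n) : BoxCfg d G n := (boxEdges d n).restrict (gaugeFix (ext u))

/-- Its free part `V|_{E_n^1}` (the random configuration `V` of Lemma 9.3). [cite: arXiv160201222, Lemma 9.3] -/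
def freePart (u : BoxCfg d G n) : FreeCfg d G n := fun e => gaugeFixBox u e.1

/-- `ext₁ v` on a comb edge. [folklore] -/
theorem ext₁_apply_of_isComb (v : FreeCfg d G n) {e : ↥(boxEdges d n)} (h : IsComb e.1) :
    ext₁ v e = 1 := dif_pos h

/-- `ext₁ v` on a free edge. [folklore] -/
theorem ext₁_apply_of_not_isComb (v : FreeCfg d G n) {e : ↥(boxEdges d n)} (h : ¬ IsComb e.1) :
    ext₁ v e = v ⟨e, h⟩ := dif_neg h

/-- **Prop. 9.2 on the box**: the gauge-fixed configuration is `1` on the comb tree and equals its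
free part elsewhere. [cite: arXiv160201222, Prop. 9.2] -/
theorem gaugeFixBox_eq_ext₁_freePart (u : BoxCfg d G n) : gaugeFixBox u = ext₁ (freePart u) := by
  funext e
  by_cases h : IsComb e.1
  · rw [ext₁_apply_of_isComb _ h]
    obtain ⟨⟨x, i⟩, he⟩ := e
    have hx : 0 ≤ x i := ((mem_boxEdges_iff.1 he).1 i).1
    exact gaugeFix_of_isComb h hx
  · rw [ext₁_apply_of_not_isComb _ h]; rfl

variable {N : ℕ} (ρ : G →* Matrix (Fin N) (Fin N) ℂ)

/-- The Wilson action of `B_n` only reads the edges of `B_n`. [cite: arXiv160201222, §2] -/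
theorem zdWilsonAction_congr {U V : ZdGaugeConfig d G} (h : ∀ e ∈ boxEdges d n, U e = V e) :
    zdWilsonAction ρ (halfOpenBox d n) U = zdWilsonAction ρ (halfOpenBox d n) V := by
  refine Finset.sum_congr rfl fun p hp => ?_
  obtain ⟨h1, h2, h3, h4⟩ := edges_mem_boxEdges hp
  rw [plaquette_congr (h _ h1) (h _ h2) (h _ h3) (h _ h4)]

/-- In particular `S_{B_n}(U) = S_{B_n}(ext (U|_{E_n}))`. [cite: arXiv160201222, §2] -/
theorem zdWilsonAction_ext_restrict (U : ZdGaugeConfig d G) :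
    zdWilsonAction ρ (halfOpenBox d n) (ext ((boxEdges d n).restrict U)) =
      zdWilsonAction ρ (halfOpenBox d n) U :=
  zdWilsonAction_congr ρ fun _ he => ext_restrict_apply U he

/-- **Prop. 9.1 (gauge invariance of the Wilson action)**. [cite: arXiv160201222, Prop. 9.1] -/
theorem zdWilsonAction_gaugeTransformZd (Λ : Finset (ZSite d)) (g : ZSite d → G) (U : ZdGaugeConfig d G) :
    zdWilsonAction ρ Λ (gaugeTransformZd g U) = zdWilsonAction ρ Λ U := by
  refine Finset.sum_congr rfl fun q _ => ?_
  have h : ZdGaugeConfig.plaquette (gaugeTransformZd g U) q.1 q.2.1 q.2.2 =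
      g q.1 * U.plaquette q.1 q.2.1 q.2.2 * (g q.1)⁻¹ :=
    plaquetteHolonomyZd_gaugeTransformZd g U q.1 q.2.1 q.2.2
  rw [h, map_mul, map_mul, Matrix.trace_mul_cycle, ← map_mul, inv_mul_cancel, map_one, Matrix.one_mul]

/-- The Wilson action of `B_n` is invariant under the axial gauge fixing of box configurations. [cite: arXiv160201222, Prop. 9.1] -/
theorem zdWilsonAction_ext_gaugeFixBox (u : BoxCfg d G n) :
    zdWilsonAction ρ (halfOpenBox d n) (ext (gaugeFixBox u)) = zdWilsonAction ρ (halfOpenBox d n) (ext u) := by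
  rw [gaugeFixBox, zdWilsonAction_ext_restrict, gaugeFix, zdWilsonAction_gaugeTransformZd]

end BoxCfgBasics

/-! ### Measurability -/

section Measurability

variable {n : ℕ} [MeasurableSpace G]

/-- `ext` is measurable. [folklore] -/
theorem measurable_ext : Measurable (ext (d := d) (G := G) (n := n)) := by
  refine measurable_pi_lambda _ fun e => ?_
  by_cases h : e ∈ boxEdges d n
  · simp only [ext, dif_pos h]; exact measurable_pi_apply _
  · simp only [ext, dif_neg h]; exact measurable_const

/-- `ext₁` is measurable. [folklore] -/
theorem measurable_ext₁ : Measurable (ext₁ (d := d) (G := G) (n := n)) := by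
  refine measurable_pi_lambda _ fun e => ?_
  by_cases h : IsComb e.1
  · simp only [ext₁, dif_pos h]; exact measurable_const
  · simp only [ext₁, dif_neg h]; exact measurable_pi_apply _

variable [TopologicalSpace G] [IsTopologicalGroup G] [BorelSpace G] [SecondCountableTopology G]

/-- Straight-line holonomies are measurable functions of the configuration. [folklore] -/
theorem measurable_line (k : Fin d) : ∀ (m : ℕ) (y : ZSite d),
    Measurable fun U : ZdGaugeConfig d G => U.line k m y
  | 0, y => by simp only [ZdGaugeConfig.line]; exact measurable_const
  | m + 1, y => by
    simp only [ZdGaugeConfig.line]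
    exact (measurable_pi_apply _).mul (measurable_line k m _)

/-- The comb gauge is a measurable function of the configuration. [folklore] -/
theorem measurable_combGauge (x : ZSite d) : Measurable fun U : ZdGaugeConfig d G => combGauge U x := by
  suffices h : ∀ j, Measurable fun U : ZdGaugeConfig d G => combGaugeAux U x j from h d
  intro j
  induction j with
  | zero => simp only [combGaugeAux]; exact measurable_const
  | succ j ih =>
    simp only [combGaugeAux]
    refine ih.mul ?_
    by_cases hjd : j < d
    · simp only [dif_pos hjd]; exact measurable_line _ _ _
    · simp only [dif_neg hjd]; exact measurable_const

/-- `gaugeFixBox` is measurable. [folklore] -/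
theorem measurable_gaugeFixBox : Measurable (gaugeFixBox (d := d) (G := G) (n := n)) := by
  refine measurable_pi_lambda _ fun e => ?_
  change Measurable fun u : BoxCfg d G n => gaugeFix (ext u) e.1
  simp only [gaugeFix_apply]
  exact (((measurable_combGauge _).comp measurable_ext).mul
    ((measurable_pi_apply _).comp measurable_ext)).mul
    ((measurable_combGauge _).comp measurable_ext).inv

/-- `freePart` is measurable. [folklore] -/
theorem measurable_freePart : Measurable (freePart (d := d) (G := G) (n := n)) :=
  measurable_pi_lambda _ fun e => (measurable_pi_apply e.1).comp measurable_gaugeFixBox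

end Measurability

/-! ### Integrals: reduction to the box and axial gauge fixing (Lemma 9.3, Cor. 9.4) -/

section Integrals

open MeasureTheory Measure

variable {n : ℕ} [TopologicalSpace G] [IsTopologicalGroup G] [CompactSpace G] [MeasurableSpace G]
  [BorelSpace G]

/-- **Reduction of `ℤ^d`-integrals of box-local functions to the finite product Haar measure
on the edges of the box.** [folklore] -/
theorem lintegral_zdHaar_eq_pi {F : ZdGaugeConfig d G → ENNReal} (hF : Measurable F)
    (hdep : ∀ U, F U = F (ext ((boxEdges d n).restrict U))) :
    ∫⁻ U, F U ∂(zdHaar d G) = ∫⁻ u, F (ext u) ∂(Measure.pi fun _ : ↥(boxEdges d n) => haarProbability G) := by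
  calc ∫⁻ U, F U ∂(zdHaar d G)
      = ∫⁻ U, (F ∘ ext) ((boxEdges d n).restrict U) ∂(Measure.infinitePi fun _ : ZdEdge d => haarProbability G) :=
        lintegral_congr fun U => hdep U
    _ = ∫⁻ u, F (ext u) ∂(Measure.pi fun _ : ↥(boxEdges d n) => haarProbability G) :=
        lintegral_restrict_infinitePi (fun _ : ZdEdge d => haarProbability G) (hF.comp measurable_ext)

variable [SecondCountableTopology G]

variable {N : ℕ} (ρ : G →* Matrix (Fin N) (Fin N) ℂ) in
/-- The partition function of `B_n` as a finite-dimensional integral: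
`Z(B_n, β) = ∫_{U(B_n)} exp(-β S_{B_n}(U)) dσ_{B_n}(U)`. [cite: arXiv160201222, §2] -/
theorem zdPartitionFunction_eq_lintegral_pi (hρ : Continuous ρ) (β : ℝ) (n : ℕ) :
    zdPartitionFunction (d := d) ρ β (halfOpenBox d n) =
      ∫⁻ u, ENNReal.ofReal (Real.exp (-β * zdWilsonAction ρ (halfOpenBox d n) (ext u)))
        ∂(Measure.pi fun _ : ↥(boxEdges d n) => haarProbability G) := by
  rw [zdPartitionFunction, zdWilsonWeight, withDensity_apply _ MeasurableSet.univ, Measure.restrict_univ]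
  refine lintegral_zdHaar_eq_pi (F := fun U => ENNReal.ofReal (Real.exp (-β * zdWilsonAction ρ _ U)))
    ?_ fun U => by simp only [zdWilsonAction_ext_restrict]
  exact ENNReal.measurable_ofReal.comp (Real.measurable_exp.comp
    ((AreaLaw.continuous_zdWilsonAction ρ hρ _).measurable.const_mul _))

/-- **Lemma 9.3 (axial gauge fixing preserves the product structure)**: under the product Haar
measure on `G^{E_n}`, the free part `V|_{E_n^1}` of the axially gauge-fixed configuration is
distributed according to the product Haar measure on `G^{E_n^1}`. Proof as printed: conditionally
on the comb-tree variables, each `V(x,y) = G_U(x) U(x,y) G_U(y)⁻¹`, `(x,y) ∈ E_n^1`, is a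
two-sided translate of an independent Haar variable (`MeasurePreserving.skew_product`). [cite: arXiv160201222, Lemma 9.3] -/
theorem map_freePart_pi :
    (Measure.pi fun _ : ↥(boxEdges d n) => haarProbability G).map freePart =
      Measure.pi fun _ : {e : ↥(boxEdges d n) // ¬ IsComb e.1} => haarProbability G := by
  classical
  set p : ↥(boxEdges d n) → Prop := fun e => IsComb e.1 with hp
  set π := Measure.pi fun _ : ↥(boxEdges d n) => haarProbability G with hπ
  set π₀ := Measure.pi fun _ : {e : ↥(boxEdges d n) // p e} => haarProbability G with hπ₀
  set π₁ := Measure.pi fun _ : {e : ↥(boxEdges d n) // ¬ p e} => haarProbability G with hπ₁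
  set e₀ := MeasurableEquiv.piEquivPiSubtypeProd (fun _ : ↥(boxEdges d n) => G) p with he₀
  have hmp : MeasurePreserving e₀ π (π₀.prod π₁) := measurePreserving_piEquivPiSubtypeProd _ p
  -- the comb gauge as a function of the tree part only
  set A : ({e : ↥(boxEdges d n) // p e} → G) → ZSite d → G :=
    fun t x => combGauge (ext (e₀.symm (t, fun _ => 1))) x with hA
  have hAu : ∀ (u : BoxCfg d G n) (x : ZSite d), combGauge (ext u) x = A (e₀ u).1 x := by
    intro u x
    refine combGauge_congr (fun e he => ?_) x
    by_cases hmem : e ∈ boxEdges d n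
    · rw [ext_apply_of_mem _ hmem, ext_apply_of_mem _ hmem]
      have hpe : p ⟨e, hmem⟩ := he
      simp [he₀, MeasurableEquiv.piEquivPiSubtypeProd, Equiv.piEquivPiSubtypeProd, hpe]
    · rw [ext_apply_of_not_mem _ hmem, ext_apply_of_not_mem _ hmem]
  have hAm : ∀ x : ZSite d, Measurable fun t => A t x := fun x =>
    (measurable_combGauge x).comp (measurable_ext.comp (e₀.symm.measurable.comp
      (measurable_id.prodMk measurable_const)))
  -- the conditional two-sided translation
  set K : ({e : ↥(boxEdges d n) // p e} → G) → ({e : ↥(boxEdges d n) // ¬ p e} → G) →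
      ({e : ↥(boxEdges d n) // ¬ p e} → G) :=
    fun t w e => A t e.1.1.1 * w e * (A t (e.1.1.1 + Pi.single e.1.1.2 1))⁻¹ with hK
  have hKfree : ∀ t w, freePart (e₀.symm (t, w)) = K t w := by
    intro t w
    funext e
    change gaugeFix (ext (e₀.symm (t, w))) e.1.1 = _
    rw [gaugeFix_apply, hAu, hAu, e₀.apply_symm_apply, ext_apply_of_mem _ e.1.2]
    simp only [hK]
    congr 2
    have hne : ¬ p e.1 := e.2
    simp [he₀, MeasurableEquiv.piEquivPiSubtypeProd, Equiv.piEquivPiSubtypeProd, hne]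
  have hKpres : ∀ t, MeasurePreserving (K t) π₁ π₁ := fun t =>
    measurePreserving_pi _ _ fun e =>
      (measurePreserving_mul_right (haarProbability G) _).comp
        (measurePreserving_mul_left (haarProbability G) _)
  have hKmeas : Measurable (Function.uncurry K) := by
    refine measurable_pi_lambda _ fun e => ?_
    exact (((hAm _).comp measurable_fst).mul ((measurable_pi_apply e).comp measurable_snd)).mul
      ((hAm _).comp measurable_fst).inv
  have hskew : MeasurePreserving (fun q : _ × _ => (q.1, K q.1 q.2)) (π₀.prod π₁) (π₀.prod π₁) :=
    (MeasurePreserving.id π₀).skew_product hKmeas (Filter.Eventually.of_forall fun t => (hKpres t).map_eq)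
  -- assemble
  have hcomp : freePart ∘ e₀.symm = Prod.snd ∘ fun q : _ × _ => (q.1, K q.1 q.2) := by
    funext ⟨t, w⟩; exact hKfree t w
  calc π.map freePart = ((π₀.prod π₁).map e₀.symm).map freePart := by rw [hmp.symm.map_eq]
    _ = (π₀.prod π₁).map (freePart ∘ e₀.symm) := Measure.map_map measurable_freePart e₀.symm.measurable
    _ = ((π₀.prod π₁).map fun q : _ × _ => (q.1, K q.1 q.2)).map Prod.snd := by
        rw [hcomp, Measure.map_map measurable_snd hskew.measurable]
    _ = (π₀.prod π₁).map Prod.snd := by rw [hskew.map_eq]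
    _ = π₁ := by rw [Measure.map_snd_prod, measure_univ, one_smul]

/-- **Cor. 9.4 (integration in the axial gauge)**: for a measurable `Φ ≥ 0` on `U(B_n)` invariant
under the axial gauge fixing `U ↦ G_U · U`,
`∫_{U(B_n)} Φ dσ_{B_n} = ∫_{G^{E_n^1}} Φ(1 on E_n^0, v on E_n^1) dσ^{E_n^1}(v)`. [cite: arXiv160201222, Cor. 9.4] -/
theorem lintegral_pi_eq_lintegral_free {Φ : BoxCfg d G n → ENNReal} (hΦ : Measurable Φ)
    (hinv : ∀ u, Φ (gaugeFixBox u) = Φ u) :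
    ∫⁻ u, Φ u ∂(Measure.pi fun _ : ↥(boxEdges d n) => haarProbability G) =
      ∫⁻ v, Φ (ext₁ v) ∂(Measure.pi fun _ : {e : ↥(boxEdges d n) // ¬ IsComb e.1} => haarProbability G) := by
  calc ∫⁻ u, Φ u ∂(Measure.pi fun _ : ↥(boxEdges d n) => haarProbability G)
      = ∫⁻ u, (Φ ∘ ext₁) (freePart u) ∂(Measure.pi fun _ : ↥(boxEdges d n) => haarProbability G) :=
        lintegral_congr fun u => by rw [Function.comp_apply, ← gaugeFixBox_eq_ext₁_freePart, hinv]
    _ = ∫⁻ v, (Φ ∘ ext₁) v ∂((Measure.pi fun _ : ↥(boxEdges d n) => haarProbability G).map freePart) :=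
        (lintegral_map (hΦ.comp measurable_ext₁) measurable_freePart).symm
    _ = _ := by rw [map_freePart_pi]; rfl

end Integrals

/-! ### Counting edges (Lemma 17.1) -/

section Counting

variable {n : ℕ}

/-- The edges of `B_n` in direction `i`, as a product set. [cite: arXiv160201222, Lemma 17.1] -/
theorem filter_boxEdges_snd_eq (n : ℕ) (i : Fin d) :
    ((boxEdges d n).filter fun e => e.2 = i) =
      (Fintype.piFinset fun k : Fin d => if k = i then Finset.Ico (0 : ℤ) (n - 1 : ℕ) else Finset.Ico (0 : ℤ) n).map
        ⟨fun x => (x, i), fun _ _ h => (Prod.ext_iff.1 h).1⟩ := by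
  ext ⟨x, j⟩
  simp only [Finset.mem_filter, Finset.mem_map, Function.Embedding.coeFn_mk, Prod.mk.injEq,
    Fintype.mem_piFinset]
  constructor
  · rintro ⟨hx, rfl⟩
    refine ⟨x, fun k => ?_, rfl, rfl⟩
    obtain ⟨h1, h2⟩ := mem_boxEdges_iff.1 hx
    by_cases hk : k = j
    · subst hk; rw [if_pos rfl, Finset.mem_Ico]; have := h1 k; omega
    · rw [if_neg hk, Finset.mem_Ico]; exact h1 k
  · rintro ⟨y, hy, rfl, rfl⟩
    refine ⟨mem_boxEdges_iff.2 ⟨fun k => ?_, ?_⟩, rfl⟩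
    · have := hy k
      by_cases hk : k = i
      · subst hk; rw [if_pos rfl, Finset.mem_Ico] at this; omega
      · rw [if_neg hk, Finset.mem_Ico] at this; exact this
    · have := hy i
      rw [if_pos rfl, Finset.mem_Ico] at this; omega

/-- `|{edges of B_n in direction i}| = (n-1) n^{d-1}`. [cite: arXiv160201222, Lemma 17.1] -/
theorem card_filter_boxEdges_snd (n : ℕ) (i : Fin d) :
    #((boxEdges d n).filter fun e => e.2 = i) = (n - 1) * n ^ (d - 1) := by
  rw [filter_boxEdges_snd_eq, Finset.card_map, Fintype.card_piFinset]
  have h : ∀ k : Fin d, #(if k = i then Finset.Ico (0 : ℤ) (n - 1 : ℕ) else Finset.Ico (0 : ℤ) n) =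
      if k = i then n - 1 else n := fun k => by
    split_ifs <;> simp
  simp only [h]
  rw [Finset.prod_ite, Finset.prod_const, Finset.prod_const]
  have c1 : #(univ.filter fun x : Fin d => x = i) = 1 := by
    rw [Finset.filter_eq', if_pos (mem_univ _), card_singleton]
  have c2 : #(univ.filter fun x : Fin d => ¬ x = i) = d - 1 := by
    have := Finset.card_filter_add_card_filter_not (s := (univ : Finset (Fin d))) (fun x : Fin d => x = i)
    rw [c1, card_univ, Fintype.card_fin] at this
    omega
  rw [c1, c2, pow_one]

/-- **Lemma 17.1, part 1**: `|E_n| = d (n-1) n^{d-1}`. [cite: arXiv160201222, Lemma 17.1] -/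
theorem card_boxEdges (n : ℕ) : #(boxEdges d n) = d * ((n - 1) * n ^ (d - 1)) := by
  rw [Finset.card_eq_sum_card_fiberwise (f := fun e : ZdEdge d => e.2) (t := univ) fun _ _ => mem_univ _]
  simp only [card_filter_boxEdges_snd, Finset.sum_const, Finset.card_univ, Fintype.card_fin, smul_eq_mul]

/-- The comb edges of `B_n`. [cite: arXiv160201222, §2] -/
def combEdges (d n : ℕ) : Finset (ZdEdge d) := (boxEdges d n).filter IsComb

/-- The free (non-comb) edges `E_n^1` of `B_n`. [cite: arXiv160201222, §2] -/
def freeEdges (d n : ℕ) : Finset (ZdEdge d) := (boxEdges d n).filter fun e => ¬ IsComb e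

/-- The endpoint map `(x, i) ↦ x + eᵢ` is a bijection from the comb edges of `B_n` onto
`B_n ∖ {0}` (the comb is a spanning tree). [cite: arXiv160201222, Lemma 17.1] -/
theorem image_combEdges (n : ℕ) :
    (combEdges d n).image (fun e : ZdEdge d => e.1 + Pi.single e.2 1) = (halfOpenBox d n).erase 0 := by
  ext y
  simp only [Finset.mem_image, combEdges, Finset.mem_filter, Finset.mem_erase, mem_halfOpenBox]
  constructor
  · rintro ⟨⟨x, i⟩, ⟨hx, hc⟩, rfl⟩
    obtain ⟨h1, h2⟩ := mem_boxEdges_iff.1 hx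
    refine ⟨fun h => ?_, fun k => ?_⟩
    · have := congr_fun h i
      simp at this; have := (h1 i).1; omega
    · by_cases hk : k = i
      · rw [hk]; simp; constructor <;> [linarith [(h1 i).1]; omega]
      · simp [Pi.single_eq_of_ne hk]; exact h1 k
  · rintro ⟨hy0, hy⟩
    have hne : (univ.filter fun k : Fin d => y k ≠ 0).Nonempty := by
      by_contra h
      rw [Finset.not_nonempty_iff_eq_empty, Finset.filter_eq_empty_iff] at h
      exact hy0 (funext fun k => by simpa using h (mem_univ k))
    set i := (univ.filter fun k : Fin d => y k ≠ 0).max' hne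
    have hi : y i ≠ 0 := (mem_filter.1 (Finset.max'_mem _ hne)).2
    have himax : ∀ k, i < k → y k = 0 := fun k hk => by
      by_contra h; exact absurd (Finset.le_max' _ k (mem_filter.2 ⟨mem_univ _, h⟩)) (not_le.2 hk)
    refine ⟨(y - Pi.single i 1, i), ⟨mem_boxEdges_iff.2 ⟨fun k => ?_, ?_⟩, fun k hk => ?_⟩, by simp⟩
    · by_cases hk : k = i
      · rw [hk]; simp; have := hy i; omega
      · simp [Pi.single_eq_of_ne hk]; exact hy k
    · simp; exact (hy i).2
    · show (y - Pi.single i (1 : ℤ) : ZSite d) k = 0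
      rw [Pi.sub_apply, Pi.single_eq_of_ne (ne_of_gt hk), sub_zero]; exact himax k hk

/-- The endpoint map is injective on comb edges. [cite: arXiv160201222, Lemma 17.1] -/
theorem injOn_combEdges (n : ℕ) :
    Set.InjOn (fun e : ZdEdge d => e.1 + Pi.single e.2 1) (combEdges d n) := by
  rintro ⟨x, i⟩ hx ⟨x', i'⟩ hx' h
  simp only [combEdges, Finset.coe_filter, Set.mem_setOf_eq] at hx hx'
  dsimp only at h
  -- the direction is the largest index of a non-zero coordinate of the endpoint
  have key : ∀ {z : ZSite d} {j : Fin d}, (z, j) ∈ boxEdges d n → IsComb (z, j) →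
      ∀ k, (j < k → (z + Pi.single j (1 : ℤ) : ZSite d) k = 0) ∧
        (z + Pi.single j (1 : ℤ) : ZSite d) j ≠ 0 := by
    intro z j hz hc k
    constructor
    · intro hk; rw [Pi.add_apply, Pi.single_eq_of_ne (ne_of_gt hk), add_zero]; exact hc k hk
    · rw [Pi.add_apply, Pi.single_eq_same]; have := ((mem_boxEdges_iff.1 hz).1 j).1; omega
  have hii' : i = i' := by
    by_contra hne
    rcases lt_or_gt_of_ne hne with hlt | hlt
    · have h1 := ((key hx'.1 hx'.2) i').2
      have h2 := ((key hx.1 hx.2) i').1 hlt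
      rw [h] at h2; exact h1 h2
    · have h1 := ((key hx.1 hx.2) i).2
      have h2 := ((key hx'.1 hx'.2) i).1 hlt
      rw [← h] at h2; exact h1 h2
  subst hii'
  have : x = x' := add_right_cancel h
  rw [this]

/-- **Lemma 17.1, part 2**: `|E_n^0| = n^d - 1`. [cite: arXiv160201222, Lemma 17.1] -/
theorem card_combEdges (n : ℕ) : #(combEdges d n) = n ^ d - 1 := by
  rcases Nat.eq_zero_or_pos n with rfl | hn
  · have h0 : boxEdges d 0 = ∅ := Finset.eq_empty_of_forall_notMem fun e h => by
      have h' := mem_boxEdges_iff.1 (show (e.1, e.2) ∈ boxEdges d 0 from h)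
      have := (h'.1 e.2).1; have := h'.2; omega
    rw [combEdges, h0, Finset.filter_empty, Finset.card_empty]
    cases d <;> simp
  · rw [← Finset.card_image_of_injOn (injOn_combEdges n), image_combEdges,
      Finset.card_erase_of_mem, card_halfOpenBox]
    exact mem_halfOpenBox.2 fun _ => by simp; omega

/-- `E_n = E_n^0 ⊔ E_n^1`. [folklore] -/
theorem card_boxEdges_eq_add (n : ℕ) : #(boxEdges d n) = #(combEdges d n) + #(freeEdges d n) := by
  rw [combEdges, freeEdges, Finset.card_filter_add_card_filter_not]

/-- **Lemma 17.1**: `|E_n^1| = (d-1) n^d - d n^{d-1} + 1` (as real numbers, `n, d ≥ 1`). [cite: arXiv160201222, Lemma 17.1] -/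
theorem card_freeEdges (hd : 1 ≤ d) (hn : 1 ≤ n) :
    (#(freeEdges d n) : ℝ) = (d - 1) * (n : ℝ) ^ d - d * (n : ℝ) ^ (d - 1) + 1 := by
  have h := card_boxEdges_eq_add (d := d) n
  rw [card_boxEdges, card_combEdges] at h
  have h' : (#(freeEdges d n) : ℝ) = (d * ((n - 1) * n ^ (d - 1)) : ℕ) - (n ^ d - 1 : ℕ) := by
    rw [h]; push_cast; ring
  rw [h', Nat.cast_sub (Nat.one_le_pow _ _ hn), Nat.cast_mul, Nat.cast_mul, Nat.cast_sub hn]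
  have hpow : (n : ℝ) ^ d = n * (n : ℝ) ^ (d - 1) := by
    rw [← pow_succ']; congr 1; omega
  push_cast
  rw [hpow]; ring

/-- The number of free edges as the cardinality of the index type of `FreeCfg`. [folklore] -/
theorem card_freeIdx (n : ℕ) :
    Fintype.card {e : ↥(boxEdges d n) // ¬ IsComb e.1} = #(freeEdges d n) := by
  rw [Fintype.card_subtype, freeEdges, Finset.card_filter, Finset.card_filter,
    ← Finset.sum_coe_sort (boxEdges d n)]

/-- `|E_n^1| ≤ d n^d`. [folklore] -/
theorem card_freeEdges_le (n : ℕ) : #(freeEdges d n) ≤ d * n ^ d := by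
  calc #(freeEdges d n) ≤ #(boxEdges d n) := Finset.card_filter_le _ _
    _ ≤ #(halfOpenBox d n ×ˢ (univ : Finset (Fin d))) := Finset.card_filter_le _ _
    _ = d * n ^ d := by rw [Finset.card_product, card_halfOpenBox, Finset.card_univ, Fintype.card_fin, mul_comm]

/-- `|x|₁ ≤ d (n - 1) ≤ d n` on `B_n`. [folklore] -/
theorem l1_le {x : ZSite d} (hx : x ∈ halfOpenBox d n) : l1 x ≤ d * n := by
  unfold l1
  calc ∑ k, (x k).toNat ≤ ∑ _k : Fin d, n := Finset.sum_le_sum fun k _ => by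
        have := (mem_halfOpenBox.1 hx k).2; omega
    _ = d * n := by rw [Finset.sum_const, Finset.card_univ, Fintype.card_fin, smul_eq_mul]

/-- The number of plaquettes of `B_n` is at most `n^d · #planes ≤ d² n^d`. [folklore] -/
theorem card_plaquettesIn_le (n : ℕ) : #(plaquettesIn (halfOpenBox d n)) ≤ d * d * n ^ d := by
  calc #(plaquettesIn (halfOpenBox d n)) ≤ #(halfOpenBox d n ×ˢ ((univ : Finset (Fin d)) ×ˢ (univ : Finset (Fin d)))) :=
        Finset.card_filter_le _ _
    _ = d * d * n ^ d := by
        rw [Finset.card_product, Finset.card_product, card_halfOpenBox, Finset.card_univ, Fintype.card_fin]; ring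

end Counting

end AxialGauge

end Literature.MathematicalPhysics.QuantumFieldTheory
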